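/-
Origin: expansion seat `planner-pub-hodgecm-pv11-g9-0`, handover ONE rewrite: `^import Pv11g9\.` -> `import HodgeCM.PerL34.` (x1: `import Pv11g9.PrintedSmoothEndState` -> `import HodgeCM.PerL34.PrintedSmoothEndState`, my RUN-30 row #6 2fd0602c); `import HodgeCM.Automorphic.SignRecipeEndStateAllChars` is tree (r29), unchanged ; after RUN 30 lands PerL34/PrintedSmoothEndState (2fd0602c); additive leaf, nothing imports it (`HOME/pub-hodgecm-pv11-g9/lean/Pv11g9/PrintedSmoothEndState7.lean`, md5 55cbec01, 184 lines);
landed by the gen-8 packager in gate run 31 as `HodgeCM/PerL34/PrintedSmoothEndState7.lean` (import ^import Pv11g9\.PrintedSmoothEndState[ \t]*$→import HodgeCM.PerL34.PrintedSmoothEndState ×1).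
-/
/-
Copyright: pub-hodgecm cell, unit pub-hodgecm-pv11-g9 (DAG-NODE PROVER #11, gen 9), node #8. Mathlib + tree only.
Origin / target: `HOME/pub-hodgecm-pv11-g9/lean/Pv11g9/PrintedSmoothEndState7.lean` → `HodgeCM/PerL34/PrintedSmoothEndState7.lean`
(imports this seat's node #6 `Pv11g9.PrintedSmoothEndState` → tree `HodgeCM.PerL34.PrintedSmoothEndState`, rewrite
`^import Pv11g9\.` ↦ `import HodgeCM.PerL34.`; plus the tree file `HodgeCM.Automorphic.SignRecipeEndStateAllChars` (r29)).
-/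
import Summits.HodgeConjecture.HodgeCM.PerL34.PrintedSmoothEndState_2
import Summits.HodgeConjecture.HodgeCM.Automorphic.SignRecipeEndStateAllChars_2

/-!
# N29 from the nine 𝒯-free fields, on the END STATE OF RECORD with `chars` eliminated (`…ofSignRecipe₇`)

Node #6 (`PrintedSmoothEndState`) discharges the input `occ` (N29 = PerL Lemma 4.1(c) / Thm 3.7 (†)) of the sign-recipe
end-state theta model `C.thetaModel h d12 d34` (`C : U.AdelicThetaCore₀`) from, per good context and pair, an instance of
pv02-g7's `LinearStr` on the Weil theta model `(C.toCore h).wm V c` and a nine-field `ArchC.LinSmoothSide` record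
(`Open_occ_thetaModel_of_linSmoothCores`), and rewrites the EIGHT-input end state `perL_ofSignRecipe₀` accordingly.

Since RUN 29 the end state of record is prl1-g6's `Assembly.realisationExists_ofSignRecipe₇` /
`perL_ofSignRecipe₇` / `COR_CM_endState_ofSignRecipe₇` (`HodgeCM/Automorphic/SignRecipeEndStateAllChars.lean`): SEVEN
all-characters non-design inputs `(C.thetaModel h d12 d34).AllCharsNonDesign` = {embCover, innerEmb, thetaSub, thetaWedge,
thetaGen12All, thetaReal34All, occ} — `chars` (N31) is no longer an input, and `occ` is VERBATIM the same proposition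
(`ThetaModel.allChars_occ_iff`).  This file is the by-name composition: the SEVEN-input end state with `occ` replaced by the
nine 𝒯-free fields, i.e. SIX all-characters inputs + (`lin`, `A12`, `A34`).

Honest label: a RESHAPING only (modus ponens of node #6 into prl1-g6's end state); what remains to discharge `occ` is the
CONSTRUCTION of an adelic linear Weil theta model carrying the nine fields (GAPS `## pub-hodgecm-pv11-g9` A7,
`HOME/pub-hodgecm-pv11-g9/ENDSTATE-S4-SPEC.md`).  Nothing is posited, nothing is cited.
-/

noncomputable section

namespace HodgeCM

namespace Universe

namespace AdelicThetaCore

open HodgeCM.PerL34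

variable {U : Universe} {hP : PrintFact_unitaryCompact} (C₀ : U.AdelicThetaCore hP) (h : Bool)
  (d12 d34 : ∀ {L : CMField}, SeesawCtx L → SideData L)

/-- **The seven all-characters inputs of the sign-recipe END-STATE model from SIX of them + the 𝒯-free linear cores**
(`occ := Open_occ_thetaModel_of_linSmoothCores`). -/
theorem allCharsNonDesign_thetaModel_of_linSmoothCores
    (lin : ∀ {L : CMField} {ι₁ : L →+* ℂ} (V : HermSpace3 L ι₁) (c : SeesawCtx L), ((C₀.toCore h).wm V c).LinearStr)
    (embCover : (C₀.thetaModel h d12 d34).Fact_embCover) (innerEmb : (C₀.thetaModel h d12 d34).Fact_innerEmb)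
    (thetaSub : (C₀.thetaModel h d12 d34).Open_thetaSub) (thetaWedge : (C₀.thetaModel h d12 d34).Open_thetaWedge)
    (thetaGen12All : (C₀.thetaModel h d12 d34).Open_thetaGen12All)
    (thetaReal34All : (C₀.thetaModel h d12 d34).Open_thetaReal34All)
    (A12 : ∀ {L : CMField} {ι₁ : L →+* ℂ} (V : HermSpace3 L ι₁) (c : SeesawCtx L),
      (C₀.thetaModel h d12 d34).GoodCtx ι₁ c →
        Nonempty ((C₀.toCore h).LinSmoothCore12 ((C₀.toCore h).side12 d12) ((C₀.toCore h).side34 d34)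
          ((C₀.toCore h).analyticKM ((C₀.toCore h).side12 d12) ((C₀.toCore h).side34 d34)).toAnalytic V c
          (ℓ := lin V c)))
    (A34 : ∀ {L : CMField} {ι₁ : L →+* ℂ} (V : HermSpace3 L ι₁) (c : SeesawCtx L),
      (C₀.thetaModel h d12 d34).GoodCtx ι₁ c →
        Nonempty ((C₀.toCore h).LinSmoothCore34 ((C₀.toCore h).side12 d12) ((C₀.toCore h).side34 d34)
          ((C₀.toCore h).analyticKM ((C₀.toCore h).side12 d12) ((C₀.toCore h).side34 d34)).toAnalytic V c
          (ℓ := lin V c))) :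
    (C₀.thetaModel h d12 d34).AllCharsNonDesign :=
  ⟨embCover, innerEmb, thetaSub, thetaWedge, thetaGen12All, thetaReal34All,
    C₀.Open_occ_thetaModel_of_linSmoothCores h d12 d34 lin A12 A34⟩

end AdelicThetaCore

end Universe

/-! ## The END STATE of record (`…ofSignRecipe₇`, `chars` eliminated) with `occ` from the nine 𝒯-free fields -/

namespace Assembly

open HodgeCM.PerL34
open HodgeCM.Universe (AdelicThetaCore AdelicThetaCore₀ AdelicTorusCore SideData ThetaModel)

variable (U : Universe)

/-- **Both realisation inputs of part (a), END STATE of record with `chars` eliminated and `occ` from nine 𝒯-FREE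
fields per good context and pair**: hypotheses = the model facts `M`, the bit `h`, the core data `C`, the side data
`d12`/`d34`, a `LinearStr` instance on each Weil theta model `(C.toCore h).wm V c`, the SIX all-characters inputs
{embCover, innerEmb, thetaSub, thetaWedge, thetaGen12All, thetaReal34All} (2 PRINT + N12, N33, N19w^all, N19g^all), the
linear smooth cores `A12`/`A34` (N29 reshaped: kind + scalings + `ArchC.LinSmoothSide`), Hodge–Riemann. -/
theorem realisationExists_ofSignRecipe₇_linSmoothCores (M : U.ModelAxioms) (h : Bool) (C : U.AdelicThetaCore₀)
    (d12 d34 : ∀ {L : CMField}, SeesawCtx L → SideData L)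
    (lin : ∀ {L : CMField} {ι₁ : L →+* ℂ} (V : HermSpace3 L ι₁) (c : SeesawCtx L), ((C.toCore h).wm V c).LinearStr)
    (embCover : (C.thetaModel h d12 d34).Fact_embCover) (innerEmb : (C.thetaModel h d12 d34).Fact_innerEmb)
    (thetaSub : (C.thetaModel h d12 d34).Open_thetaSub) (thetaWedge : (C.thetaModel h d12 d34).Open_thetaWedge)
    (thetaGen12All : (C.thetaModel h d12 d34).Open_thetaGen12All)
    (thetaReal34All : (C.thetaModel h d12 d34).Open_thetaReal34All)
    (A12 : ∀ {L : CMField} {ι₁ : L →+* ℂ} (V : HermSpace3 L ι₁) (c : SeesawCtx L),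
      (C.thetaModel h d12 d34).GoodCtx ι₁ c →
        Nonempty ((C.toCore h).LinSmoothCore12 ((C.toCore h).side12 d12) ((C.toCore h).side34 d34)
          ((C.toCore h).analyticKM ((C.toCore h).side12 d12) ((C.toCore h).side34 d34)).toAnalytic V c
          (ℓ := lin V c)))
    (A34 : ∀ {L : CMField} {ι₁ : L →+* ℂ} (V : HermSpace3 L ι₁) (c : SeesawCtx L),
      (C.thetaModel h d12 d34).GoodCtx ι₁ c →
        Nonempty ((C.toCore h).LinSmoothCore34 ((C.toCore h).side12 d12) ((C.toCore h).side34 d34)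
          ((C.toCore h).analyticKM ((C.toCore h).side12 d12) ((C.toCore h).side34 d34)).toAnalytic V c
          (ℓ := lin V c)))
    (hHR : U.Fact_hodgeRiemann20) : U.RealisationExistsPerL ∧ U.RealisationExistsFace :=
  realisationExists_ofSignRecipe₇ U M h C d12 d34
    (C.allCharsNonDesign_thetaModel_of_linSmoothCores h d12 d34 lin embCover innerEmb thetaSub thetaWedge
      thetaGen12All thetaReal34All A12 A34) hHR

/-- **PerL, END STATE of record with `chars` eliminated and `occ` from the nine 𝒯-free fields.** -/
theorem perL_ofSignRecipe₇_linSmoothCores (M : U.ModelAxioms) (h : Bool) (C : U.AdelicThetaCore₀)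
    (d12 d34 : ∀ {L : CMField}, SeesawCtx L → SideData L)
    (lin : ∀ {L : CMField} {ι₁ : L →+* ℂ} (V : HermSpace3 L ι₁) (c : SeesawCtx L), ((C.toCore h).wm V c).LinearStr)
    (embCover : (C.thetaModel h d12 d34).Fact_embCover) (innerEmb : (C.thetaModel h d12 d34).Fact_innerEmb)
    (thetaSub : (C.thetaModel h d12 d34).Open_thetaSub) (thetaWedge : (C.thetaModel h d12 d34).Open_thetaWedge)
    (thetaGen12All : (C.thetaModel h d12 d34).Open_thetaGen12All)
    (thetaReal34All : (C.thetaModel h d12 d34).Open_thetaReal34All)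
    (A12 : ∀ {L : CMField} {ι₁ : L →+* ℂ} (V : HermSpace3 L ι₁) (c : SeesawCtx L),
      (C.thetaModel h d12 d34).GoodCtx ι₁ c →
        Nonempty ((C.toCore h).LinSmoothCore12 ((C.toCore h).side12 d12) ((C.toCore h).side34 d34)
          ((C.toCore h).analyticKM ((C.toCore h).side12 d12) ((C.toCore h).side34 d34)).toAnalytic V c
          (ℓ := lin V c)))
    (A34 : ∀ {L : CMField} {ι₁ : L →+* ℂ} (V : HermSpace3 L ι₁) (c : SeesawCtx L),
      (C.thetaModel h d12 d34).GoodCtx ι₁ c →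
        Nonempty ((C.toCore h).LinSmoothCore34 ((C.toCore h).side12 d12) ((C.toCore h).side34 d34)
          ((C.toCore h).analyticKM ((C.toCore h).side12 d12) ((C.toCore h).side34 d34)).toAnalytic V c
          (ℓ := lin V c)))
    (hHR : U.Fact_hodgeRiemann20) : U.PerL :=
  perL_ofSignRecipe₇ U M h C d12 d34
    (C.allCharsNonDesign_thetaModel_of_linSmoothCores h d12 d34 lin embCover innerEmb thetaSub thetaWedge
      thetaGen12All thetaReal34All A12 A34) hHR

/-- **COR-CM, END STATE of record with `chars` eliminated and `occ` from the nine 𝒯-free fields** (hypotheses: `M`,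
M29/M30, the three [QW8]-side inputs, `h`, `C`, `d12`/`d34`, `lin`, the SIX all-characters inputs, `A12`/`A34`,
Hodge–Riemann). -/
theorem COR_CM_endState_ofSignRecipe₇_linSmoothCores (M : U.ModelAxioms) (h29 : U.Fact_weightSpan)
    (h30 : U.Fact_weightHodge) (hE : U.Qw8ExtProd) (hD : U.Qw8DualPushPull) (hMi : U.Qw8Milne) (h : Bool)
    (C : U.AdelicThetaCore₀) (d12 d34 : ∀ {L : CMField}, SeesawCtx L → SideData L)
    (lin : ∀ {L : CMField} {ι₁ : L →+* ℂ} (V : HermSpace3 L ι₁) (c : SeesawCtx L), ((C.toCore h).wm V c).LinearStr)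
    (embCover : (C.thetaModel h d12 d34).Fact_embCover) (innerEmb : (C.thetaModel h d12 d34).Fact_innerEmb)
    (thetaSub : (C.thetaModel h d12 d34).Open_thetaSub) (thetaWedge : (C.thetaModel h d12 d34).Open_thetaWedge)
    (thetaGen12All : (C.thetaModel h d12 d34).Open_thetaGen12All)
    (thetaReal34All : (C.thetaModel h d12 d34).Open_thetaReal34All)
    (A12 : ∀ {L : CMField} {ι₁ : L →+* ℂ} (V : HermSpace3 L ι₁) (c : SeesawCtx L),
      (C.thetaModel h d12 d34).GoodCtx ι₁ c →
        Nonempty ((C.toCore h).LinSmoothCore12 ((C.toCore h).side12 d12) ((C.toCore h).side34 d34)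
          ((C.toCore h).analyticKM ((C.toCore h).side12 d12) ((C.toCore h).side34 d34)).toAnalytic V c
          (ℓ := lin V c)))
    (A34 : ∀ {L : CMField} {ι₁ : L →+* ℂ} (V : HermSpace3 L ι₁) (c : SeesawCtx L),
      (C.thetaModel h d12 d34).GoodCtx ι₁ c →
        Nonempty ((C.toCore h).LinSmoothCore34 ((C.toCore h).side12 d12) ((C.toCore h).side34 d34)
          ((C.toCore h).analyticKM ((C.toCore h).side12 d12) ((C.toCore h).side34 d34)).toAnalytic V c
          (ℓ := lin V c)))
    (hHR : U.Fact_hodgeRiemann20) : U.HC_CM :=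
  COR_CM_endState_ofSignRecipe₇ U M h29 h30 hE hD hMi h C d12 d34
    (C.allCharsNonDesign_thetaModel_of_linSmoothCores h d12 d34 lin embCover innerEmb thetaSub thetaWedge
      thetaGen12All thetaReal34All A12 A34) hHR

/-- The EIGHT-input form of node #6 (`realisationExists_ofSignRecipe₀_linSmoothCores`, with `chars` and the
inputs-of-record `thetaGen12`/`thetaReal34`) is recovered from the seven-input one by prl1-g6's monotonicity
(`NonDesignInputs.allChars`): consistency check of the two reshaped end states. -/
theorem realisationExists_ofSignRecipe₀_linSmoothCores_of₇ (M : U.ModelAxioms) (h : Bool) (C : U.AdelicThetaCore₀)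
    (d12 d34 : ∀ {L : CMField}, SeesawCtx L → SideData L)
    (lin : ∀ {L : CMField} {ι₁ : L →+* ℂ} (V : HermSpace3 L ι₁) (c : SeesawCtx L), ((C.toCore h).wm V c).LinearStr)
    (embCover : (C.thetaModel h d12 d34).Fact_embCover) (innerEmb : (C.thetaModel h d12 d34).Fact_innerEmb)
    (thetaSub : (C.thetaModel h d12 d34).Open_thetaSub) (thetaWedge : (C.thetaModel h d12 d34).Open_thetaWedge)
    (thetaGen12 : (C.thetaModel h d12 d34).Open_thetaGen12)
    (thetaReal34 : (C.thetaModel h d12 d34).Open_thetaReal34) (chars : (C.thetaModel h d12 d34).Open_chars)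
    (A12 : ∀ {L : CMField} {ι₁ : L →+* ℂ} (V : HermSpace3 L ι₁) (c : SeesawCtx L),
      (C.thetaModel h d12 d34).GoodCtx ι₁ c →
        Nonempty ((C.toCore h).LinSmoothCore12 ((C.toCore h).side12 d12) ((C.toCore h).side34 d34)
          ((C.toCore h).analyticKM ((C.toCore h).side12 d12) ((C.toCore h).side34 d34)).toAnalytic V c
          (ℓ := lin V c)))
    (A34 : ∀ {L : CMField} {ι₁ : L →+* ℂ} (V : HermSpace3 L ι₁) (c : SeesawCtx L),
      (C.thetaModel h d12 d34).GoodCtx ι₁ c →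
        Nonempty ((C.toCore h).LinSmoothCore34 ((C.toCore h).side12 d12) ((C.toCore h).side34 d34)
          ((C.toCore h).analyticKM ((C.toCore h).side12 d12) ((C.toCore h).side34 d34)).toAnalytic V c
          (ℓ := lin V c)))
    (hHR : U.Fact_hodgeRiemann20) : U.RealisationExistsPerL ∧ U.RealisationExistsFace :=
  realisationExists_ofSignRecipe₇ U M h C d12 d34
    (ThetaModel.NonDesignInputs.allChars
      ⟨embCover, innerEmb, thetaSub, thetaWedge, thetaGen12, thetaReal34, chars,
        C.Open_occ_thetaModel_of_linSmoothCores h d12 d34 lin A12 A34⟩) hHR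

end Assembly

end HodgeCM

end
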